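import Literature.ModelTheory.FiniteModelTheory.CountingWidthXorHam
import HarnessLib

/-!
# A graph encoding of 3XOR systems with readable roles, and its Cai–Fürer–Immerman game

Topic `Literature/ModelTheory/FiniteModelTheory`. For a 3XOR system — scopes
`vr : Fin m → Fin 3 → Fin n` and right-hand sides `b : Fin m → 𝔽₂`, the constraints
`x_{vr u 0} + x_{vr u 1} + x_{vr u 2} = b u` — this file builds a SIMPLE GRAPH `xgraph vr b` in the
spirit of the doubled instance `G(I)` of Atserias–Dawar (2019, §3.2: variables `x⁰, x¹` and, for
every equation and every admissible sign pattern, a copy of the equation) but arranged so that the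
rôle of every vertex can be read off its DEGREE (used by `DegreeParitySystem.lean` to decode the
system in an isomorphism-invariant way):

* VALUE vertices `val x a` ("`x = a`", `a ∈ 𝔽₂`), each with three pendant LEAVES `leaf x a j`
  (so that value vertices have degree `≥ 4`);
* one TWIN TAG `tw x` per variable, adjacent to `val x 0` and `val x 1` only (degree `2`);
* CLAUSE vertices `eq u ρ` for every `u` and EVERY `ρ : Fin 3 → 𝔽₂`, ACTIVE iff `∑ ρ = b u`; an
  active clause vertex is adjacent to the three value vertices `val (vr u i) (ρ i)` (degree `3`
  for injective scopes), an inactive one is isolated (degree `0`). Keeping the inactive copies makes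
  the vertex type independent of `b` (as in the tree's `TseitinColouring.lean`), so that
* the FLIP by `f : Fin n → 𝔽₂` — `val x a ↦ val x (a + f x)` (with its leaves),
  `eq u ρ ↦ eq u (ρ + f ∘ vr u)`, `tw x ↦ tw x` — is an involution of the vertex type carrying
  `xgraph vr b` isomorphically onto `xgraph vr (b + ∂f)` (`xgraph_adj_flip_iff`; Atserias–Dawar
  2019, §3.2, the isomorphism behind Lemma 3.2).

Main result: **`ckEquiv_xgraph`** — on an `(s, q/p)`-boundary expander (`q |T| ≤ p |∂T|` for
`|T| ≤ s`), for `2pK ≤ qs` and `3k ≤ K`, `xgraph vr b ≡^{C^k} xgraph vr 0` for EVERY `b`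
(Atserias–Dawar 2019, Lemma 3.2 with Lemma 3.5), obtained from the tree's abstract transfer
`ckEquiv_of_consistencyFamily` (`CkEquivTransfer.lean`) and the consistency family of
`XorLocalConsistency.lean` packaged in `XorHamGame.isConsistencyFamily_good`, exactly as for the
Hamiltonicity gadgets of `CountingWidthXorHam.lean`.

Also: the adjacency of each kind of vertex (`adj_tw_iff`, `adj_leaf_iff`, `adj_eq_iff`,
`adj_val_iff`) and the vertex count `card_xVert` (`9n + 8m`).

## References

* A. Atserias, A. Dawar, *Definable inapproximability: new challenges for duplicator*, J. Logic
  Comput. 29 (2019), arXiv:1806.11307, §3.2 (the instance `G(I)`), Lemma 3.2 and its proof (the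
  flip isomorphisms and Duplicator's strategy), Lemma 3.5 [AtseriasDawar2019].
* J.-Y. Cai, M. Fürer, N. Immerman, *An optimal lower bound on the number of variables for graph
  identification*, Combinatorica 12 (1992), §6 (the original construction) [CaiFurerImmerman1992].

## Design notes

The encoding (twin tags, pendant leaves) is this file's; only its mechanism (value copies, clause
copies for admissible sign patterns, flips) is the cited one. Scopes need not be injective for the
game; injectivity is only needed for the degree count of clause vertices (next file).
-/

namespace Literature.ModelTheory.FiniteModelTheory

open Finset Literature.Combinatorics.SimpleGraph

/-- **The vertices of the encoding graph** of a 3XOR system with `n` variables and `m` clauses: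
value vertices `val x a`, their pendant leaves `leaf x a j` (`j < 3`), twin tags `tw x`, and clause
vertices `eq u ρ` for every sign pattern `ρ : Fin 3 → 𝔽₂`. [cite: AtseriasDawar2019, §3.2 (G(I))] -/
inductive XVert (n m : ℕ) : Type
  | val (x : Fin n) (a : ZMod 2)
  | leaf (x : Fin n) (a : ZMod 2) (j : Fin 3)
  | tw (x : Fin n)
  | eq (u : Fin m) (ρ : Fin 3 → ZMod 2)
  deriving DecidableEq, Fintype

namespace XVert

variable {n m : ℕ}

/-- **The vertex count**: `|XVert n m| = 9n + 8m` (`2n` value vertices, `6n` leaves, `n` twin tags,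
`8m` clause vertices). [folklore] -/
theorem card_xVert (n m : ℕ) : Fintype.card (XVert n m) = 9 * n + 8 * m := by
  rw [Fintype.card_eq.2 ⟨(XVert.proxyTypeEquiv n m).symm⟩]
  simp [Fintype.card_sum, ZMod.card, Fintype.card_fin]
  ring

variable (vr : Fin m → Fin 3 → Fin n)

/-- **The generating relation of the encoding graph** with right-hand sides `b`: twin tags and
leaves point to their value vertices; an ACTIVE clause vertex (`∑ ρ = b u`) points to the value
vertices `val (vr u i) (ρ i)`. [cite: AtseriasDawar2019, §3.2 (G(I))] -/
def xrel (b : Fin m → ZMod 2) : XVert n m → XVert n m → Prop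
  | tw x, val x' _ => x = x'
  | leaf x a _, val x' a' => x = x' ∧ a = a'
  | eq u ρ, val x a => (∑ i, ρ i) = b u ∧ ∃ i, vr u i = x ∧ ρ i = a
  | _, _ => False

/-- **The encoding graph `X(vr, b)`** (symmetrised, loopless). [cite: AtseriasDawar2019, §3.2 (G(I))] -/
def xgraph (b : Fin m → ZMod 2) : SimpleGraph (XVert n m) := SimpleGraph.fromRel (xrel vr b)

variable {vr} {b : Fin m → ZMod 2}

/-- Nothing points to a leaf, a twin tag or a clause vertex. [folklore] -/
theorem xrel_right_cases {p q : XVert n m} (h : xrel vr b p q) : ∃ x a, q = val x a := by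
  cases p <;> cases q <;> first | exact ⟨_, _, rfl⟩ | exact h.elim

/-- A value vertex points to nothing. [folklore] -/
theorem not_xrel_val (x : Fin n) (a : ZMod 2) (q : XVert n m) : ¬ xrel vr b (val x a) q := by
  cases q <;> exact id

/-- Adjacency from a non-value vertex is the generating relation. [folklore] -/
theorem adj_iff_xrel_of_ne_val {p : XVert n m} (hp : ∀ x a, p ≠ val x a) (q : XVert n m) :
    (xgraph vr b).Adj p q ↔ xrel vr b p q := by
  rw [xgraph, SimpleGraph.fromRel_adj]
  constructor
  · rintro ⟨-, h | h⟩
    · exact h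
    · obtain ⟨x, a, rfl⟩ := xrel_right_cases h
      exact absurd rfl (hp x a)
  · intro h
    obtain ⟨x, a, rfl⟩ := xrel_right_cases h
    exact ⟨hp x a, Or.inl h⟩

/-- **Neighbours of a twin tag**: the two values of its variable. [folklore] -/
theorem adj_tw_iff (x : Fin n) (q : XVert n m) :
    (xgraph vr b).Adj (tw x) q ↔ q = val x 0 ∨ q = val x 1 := by
  rw [adj_iff_xrel_of_ne_val (fun _ _ h => by cases h)]
  cases q with
  | val x' a =>
    show x = x' ↔ _
    constructor
    · rintro rfl
      rcases (by decide : ∀ a : ZMod 2, a = 0 ∨ a = 1) a with rfl | rfl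
      · exact Or.inl rfl
      · exact Or.inr rfl
    · rintro (h | h) <;> cases h <;> rfl
  | _ => exact ⟨fun h => h.elim, fun h => by rcases h with h | h <;> cases h⟩

/-- **Neighbours of a leaf**: its value vertex. [folklore] -/
theorem adj_leaf_iff (x : Fin n) (a : ZMod 2) (j : Fin 3) (q : XVert n m) :
    (xgraph vr b).Adj (leaf x a j) q ↔ q = val x a := by
  rw [adj_iff_xrel_of_ne_val (fun _ _ h => by cases h)]
  cases q with
  | val x' a' =>
    show x = x' ∧ a = a' ↔ _
    constructor
    · rintro ⟨rfl, rfl⟩; rfl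
    · intro h; cases h; exact ⟨rfl, rfl⟩
  | _ => exact ⟨fun h => h.elim, fun h => by cases h⟩

/-- **Neighbours of a clause vertex**: none if inactive, the three literal values if active.
[cite: AtseriasDawar2019, §3.2 (G(I))] -/
theorem adj_eq_iff (u : Fin m) (ρ : Fin 3 → ZMod 2) (q : XVert n m) :
    (xgraph vr b).Adj (eq u ρ) q ↔ (∑ i, ρ i) = b u ∧ ∃ i, q = val (vr u i) (ρ i) := by
  rw [adj_iff_xrel_of_ne_val (fun _ _ h => by cases h)]
  cases q with
  | val x a =>
    show (∑ i, ρ i) = b u ∧ (∃ i, vr u i = x ∧ ρ i = a) ↔ _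
    refine and_congr_right fun _ => ⟨?_, ?_⟩
    · rintro ⟨i, rfl, rfl⟩; exact ⟨i, rfl⟩
    · rintro ⟨i, h⟩; cases h; exact ⟨i, rfl, rfl⟩
  | _ => exact ⟨fun h => h.elim, fun h => by obtain ⟨-, i, h⟩ := h; cases h⟩

/-- **Neighbours of a value vertex**: its twin tag, its three leaves, and the active clause vertices
having it as a literal. [cite: AtseriasDawar2019, §3.2 (G(I))] -/
theorem adj_val_iff (x : Fin n) (a : ZMod 2) (q : XVert n m) :
    (xgraph vr b).Adj (val x a) q ↔ q = tw x ∨ (∃ j, q = leaf x a j) ∨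
      ∃ u ρ, q = eq u ρ ∧ (∑ i, ρ i) = b u ∧ ∃ i, vr u i = x ∧ ρ i = a := by
  rw [(xgraph vr b).adj_comm]
  cases q with
  | val x' a' =>
    rw [xgraph, SimpleGraph.fromRel_adj]
    constructor
    · rintro ⟨-, h | h⟩ <;> exact (not_xrel_val _ _ _ h).elim
    · rintro (h | ⟨j, h⟩ | ⟨u, ρ, h, -⟩) <;> cases h
  | tw x' =>
    rw [adj_tw_iff]
    constructor
    · rintro (h | h) <;> cases h <;> exact Or.inl rfl
    · rintro (h | ⟨j, h⟩ | ⟨u, ρ, h, -⟩) <;> cases h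
      rcases (by decide : ∀ a : ZMod 2, a = 0 ∨ a = 1) a with rfl | rfl
      · exact Or.inl rfl
      · exact Or.inr rfl
  | leaf x' a' j =>
    rw [adj_leaf_iff]
    constructor
    · intro h; cases h; exact Or.inr (Or.inl ⟨j, rfl⟩)
    · rintro (h | ⟨j', h⟩ | ⟨u, ρ, h, -⟩) <;> cases h; rfl
  | eq u ρ =>
    rw [adj_eq_iff]
    constructor
    · rintro ⟨hs, i, h⟩
      cases h
      exact Or.inr (Or.inr ⟨u, ρ, rfl, hs, i, rfl, rfl⟩)
    · rintro (h | ⟨j, h⟩ | ⟨u', ρ', h, hs, i, rfl, rfl⟩)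
      · cases h
      · cases h
      · cases h
        exact ⟨hs, i, rfl⟩

/-! ### Flips -/

variable (vr)

/-- **The flip by `f`**: `val x a ↦ val x (a + f x)` (with its leaves), `tw x ↦ tw x`,
`eq u ρ ↦ eq u (ρ + f ∘ vr u)`. [cite: AtseriasDawar2019, Lemma 3.2 (proof: "x_l^a ↦ x_l^{a+f(x_l)}")] -/
def flip (f : Fin n → ZMod 2) : XVert n m → XVert n m
  | val x a => val x (a + f x)
  | leaf x a j => leaf x (a + f x) j
  | tw x => tw x
  | eq u ρ => eq u fun i => ρ i + f (vr u i)

/-- Flipping twice by the same `f` is the identity. [folklore] -/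
theorem flip_flip (f : Fin n → ZMod 2) (p : XVert n m) : flip vr f (flip vr f p) = p := by
  cases p <;> simp [flip, XorHam.add_add_cancel_zmod2]

/-- The flip as a permutation of the vertices. [cite: AtseriasDawar2019, Lemma 3.2 (proof)] -/
def flipEquiv (f : Fin n → ZMod 2) : XVert n m ≃ XVert n m :=
  Function.Involutive.toPerm (flip vr f) (flip_flip vr f)

/-- `flipEquiv` is `flip`. [folklore] -/
@[simp] theorem flipEquiv_apply (f : Fin n → ZMod 2) (p : XVert n m) : flipEquiv vr f p = flip vr f p := rfl

/-- The boundary `∂f` of an assignment: `(∂f) u = ∑ i, f (vr u i)`. [cite: AtseriasDawar2019, §3.2] -/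
def bdry (f : Fin n → ZMod 2) : Fin m → ZMod 2 := fun u => ∑ i, f (vr u i)

/-- The clause a vertex belongs to, if any. [folklore] -/
def clauseOf : XVert n m → Option (Fin m)
  | eq u _ => some u
  | _ => none

variable {vr}

/-- **The flip transports the generating relation**: `xrel b' (flip f p) (flip f q) ↔ xrel b p q`
whenever `b' u + (∂f) u = b u` at the clauses of `p` and `q`.
[cite: AtseriasDawar2019, Lemma 3.2 (proof)] -/
theorem xrel_flip_iff {b b' : Fin m → ZMod 2} (f : Fin n → ZMod 2) {p q : XVert n m}
    (h : ∀ u, (clauseOf p = some u ∨ clauseOf q = some u) → b' u + bdry vr f u = b u) :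
    xrel vr b' (flip vr f p) (flip vr f q) ↔ xrel vr b p q := by
  cases p with
  | val x a => cases q <;> exact Iff.rfl
  | leaf x a j =>
    cases q with
    | val x' a' =>
      show x = x' ∧ a + f x = a' + f x' ↔ x = x' ∧ a = a'
      constructor
      · rintro ⟨rfl, h2⟩; exact ⟨rfl, add_right_cancel h2⟩
      · rintro ⟨rfl, rfl⟩; exact ⟨rfl, rfl⟩
    | _ => exact Iff.rfl
  | tw x => cases q <;> exact Iff.rfl
  | eq u ρ =>
    cases q with
    | val x a =>
      have hu := h u (Or.inl rfl)
      show ((∑ i, (ρ i + f (vr u i))) = b' u ∧ ∃ i, vr u i = x ∧ ρ i + f (vr u i) = a + f x) ↔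
        ((∑ i, ρ i) = b u ∧ ∃ i, vr u i = x ∧ ρ i = a)
      rw [Finset.sum_add_distrib, ← hu]
      refine and_congr ⟨fun h1 => ?_, fun h1 => ?_⟩ (exists_congr fun i => and_congr_right ?_)
      · have := congrArg (· + bdry vr f u) h1
        simpa only [bdry, XorHam.add_add_cancel_zmod2] using this
      · rw [h1]; exact XorHam.add_add_cancel_zmod2 (b' u) (bdry vr f u)
      · rintro rfl; exact ⟨fun h2 => add_right_cancel h2, fun h2 => by rw [h2]⟩
    | _ => exact Iff.rfl

/-- The flip keeps the clause. [folklore] -/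
@[simp] theorem clauseOf_flip (f : Fin n → ZMod 2) (p : XVert n m) : clauseOf (flip vr f p) = clauseOf p := by
  cases p <;> rfl

/-- **The flip is an isomorphism `X(vr,b) ≅ X(vr,b')` locally**: adjacency of `flip f p`, `flip f q`
in `X(vr, b')` is adjacency of `p`, `q` in `X(vr, b)` whenever `b' + ∂f = b` at their clauses.
[cite: AtseriasDawar2019, Lemma 3.2 (proof)] -/
theorem xgraph_adj_flip_iff {b b' : Fin m → ZMod 2} (f : Fin n → ZMod 2) {p q : XVert n m}
    (h : ∀ u, (clauseOf p = some u ∨ clauseOf q = some u) → b' u + bdry vr f u = b u) :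
    (xgraph vr b').Adj (flip vr f p) (flip vr f q) ↔ (xgraph vr b).Adj p q := by
  rw [xgraph, xgraph, SimpleGraph.fromRel_adj, SimpleGraph.fromRel_adj]
  have hinj : flip vr f p = flip vr f q ↔ p = q :=
    (flipEquiv vr f).injective.eq_iff
  rw [ne_eq, hinj, xrel_flip_iff f h, xrel_flip_iff f fun u hu => h u hu.symm]

/-! ### Data, locality, and the game -/

variable (vr)

/-- **The data of a vertex**: its variable, or the scope of its clause.
[cite: AtseriasDawar2019, Lemma 3.2 (proof)] -/
def xdata : XVert n m → Finset (Fin n)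
  | val x _ => {x}
  | leaf x _ _ => {x}
  | tw x => {x}
  | eq u _ => XorHamGame.scope vr u

/-- Every vertex has at most three data variables. [folklore] -/
theorem card_xdata_le (p : XVert n m) : (xdata vr p).card ≤ 3 := by
  cases p <;> simp [xdata, XorHamGame.card_scope_le]

variable {vr}

/-- A clause vertex carries the scope of its clause. [folklore] -/
theorem xdata_of_clauseOf {p : XVert n m} {u : Fin m} (h : clauseOf p = some u) :
    xdata vr p = XorHamGame.scope vr u := by
  cases p <;> simp only [clauseOf, Option.some.injEq, reduceCtorEq] at h
  subst h; rfl

/-- **Locality of the flips**: the image of `p` depends only on `f` on the data of `p`. [folklore] -/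
theorem flip_congr {f g : Fin n → ZMod 2} {p : XVert n m} (h : ∀ v ∈ xdata vr p, f v = g v) :
    flip vr f p = flip vr g p := by
  cases p with
  | val x a => simp only [flip, h x (by simp [xdata])]
  | leaf x a j => simp only [flip, h x (by simp [xdata])]
  | tw x => rfl
  | eq u ρ =>
    simp only [flip, XVert.eq.injEq, true_and]
    funext i
    rw [h (vr u i) (by simp [xdata, XorHamGame.scope])]

/-- The flips form a local flip action for the data map. [folklore] -/
theorem isLocalFlipAction_flip : IsLocalFlipAction (xdata vr) (flipEquiv vr) :=
  ⟨fun _ _ p hfg => flip_congr hfg, fun f p => by cases p <;> rfl⟩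

/-- **Consistent flips are partial isomorphisms onto the homogeneous encoding**: if `f` is consistent
at radius `s ≥ 1` (`XorSystem.Good`) on a domain containing the data of `p` and `q`, flipping by `f`
carries `X(vr,b)`-adjacency of `p, q` onto `X(vr,0)`-adjacency.
[cite: AtseriasDawar2019, Lemma 3.2 (proof)] -/
theorem xgraph_adj_flip_zero_iff (hvr : ∀ u, Function.Injective (vr u)) {s : ℕ} (hs : 1 ≤ s)
    {dom : Finset (Fin n)} {f : Fin n → ZMod 2}
    (hg : XorSystem.Good (XorHamGame.scope vr) b s dom f) {p q : XVert n m}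
    (hp : xdata vr p ⊆ dom) (hq : xdata vr q ⊆ dom) :
    (xgraph vr 0).Adj (flip vr f p) (flip vr f q) ↔ (xgraph vr b).Adj p q := by
  refine xgraph_adj_flip_iff f fun u hu => ?_
  have hsub : XorHamGame.scope vr u ⊆ dom := by
    rcases hu with hu | hu
    · rw [← xdata_of_clauseOf hu]; exact hp
    · rw [← xdata_of_clauseOf hu]; exact hq
  have hsum := hg.sum_scope_eq hs hsub
  rw [XorHamGame.scope, Finset.sum_image fun i _ j _ e => hvr u e] at hsum
  show (0 : ZMod 2) + ∑ i, f (vr u i) = b u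
  rw [zero_add, hsum]

/-- **The Cai–Fürer–Immerman / Atserias–Dawar game on the encoding graphs**: on an
`(s, q/p)`-boundary expander (`q |T| ≤ p |∂T|` for `|T| ≤ s`), whenever `2pK ≤ qs` and `3k ≤ K`,
`X(vr, b) ≡^{C^k} X(vr, 0)` for EVERY right-hand side `b` (Atserias–Dawar 2019, Lemma 3.2 with
Lemma 3.5; Duplicator flips by consistent partial assignments, `ckEquiv_of_consistencyFamily`).
[cite: AtseriasDawar2019, Lemma 3.2 with Lemma 3.5] -/
theorem ckEquiv_xgraph (hvr : ∀ u, Function.Injective (vr u)) {s p q K k : ℕ} (hs : 1 ≤ s)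
    (hq : 0 < q)
    (hexp : ∀ T : Finset (Fin m), T.card ≤ s →
      q * T.card ≤ p * (XorSystem.boundary (XorHamGame.scope vr) T).card)
    (hK : 2 * p * K ≤ q * s) (hk : 3 * k ≤ K) (b : Fin m → ZMod 2) :
    CkEquiv k (xgraph vr b) (xgraph vr 0) := by
  classical
  have hG := XorHamGame.isConsistencyFamily_good (S := XorHamGame.scope vr) (b := b) hq hexp hK
  exact ckEquiv_of_consistencyFamily (R := ZMod 2) hG isLocalFlipAction_flip (card_xdata_le vr)
    (fun dom f p q hgood hp hq => xgraph_adj_flip_zero_iff hvr hs hgood hp hq) hk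

end XVert

end Literature.ModelTheory.FiniteModelTheory
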